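import Mathlib
import HarnessLib

/-!
# HodgeLocusCensusLongCycleCore — kernel-checked CORES of the JOIN LAW and of the LONG-CYCLE THEOREM (cell pub-hlocus, LEAD gen 27; rulings R-L18 / R-L20)
HONEST FRAMING: certified instances and evidence bearing on the general Hodge conjecture; no claim.

Computational / structural helper of the Hodge-locus census; nothing here is used by, or claims anything about, `Summit.HodgeConjecture`.
Records: `data/ivhs/census/og81/FERMAT-MATCH-BOOLEAN-JOINLAW-g26.md` §3 (the JOIN LAW e(B ⊔ [2]^j; λ) = Σ_s C(j,s) e_{3−s}(B; λ), proved on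
paper from "rank(f ⊗ g) = rank f · rank g" and direct-sum additivity) and `data/ivhs/census/og81/LONG-CYCLE-THEOREM-g27.md` (every cubic cell
(2k−2, 3, m) with c′ = k−1−m ≥ 4 has μ₀ ≡ 1 on ℂ^×; its Prop. C is a pigeonhole on ℤ/k plus five explicit residual cases).  This file kernel-checks
EXACTLY the following ingredients and nothing more (the dictionary 'first-order keys at X_F = ranks in ℚ[x]/(x_i²)', Lemma A, Lemma B and the walk
lemma D of the record stay on paper):

* `finrank_range_tensorProduct_map` — over a field, dim range(f ⊗ g) = dim range f · dim range g (via `TensorProduct.range_map`, flatness of vector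
  spaces and `Module.finrank_tensorProduct`); `rank_kronecker` — rank (A ⊗ₖ B) = rank A · rank B for matrices over a field (the engine of the JOIN LAW);
  `finrank_range_prodMap` — dim range(f × g) = dim range f + dim range g (its direct-sum half).
* `exists_consecutive_outside` — if 2·|τ| < k then some i ∈ ℤ/k has i ∉ τ and i+1 ∉ τ (the kill criterion of Prop. C for (t,k) = (1,≥3), (2,≥5),
  (3,≥7): `longCycle_kill_t1/t2/t3`); and the RESIDUAL subsets where the criterion fails, decided: at k = 5 the five rotations of {0,2,4}, at k = 6
  the two triples {0,2,4}, {1,3,5}, at (t,k) = (2,4) the pairs {0,2}, {1,3} (`residual_k5`, `residual_k6`, `residual_t2_k4`, `residual_k7`; `mem_residual_iff`) — exactly the cases the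
  record settles by explicit second-stage witnesses.
-/

namespace Summit.HodgeConjecture.HodgeConjecture.HodgeLocus.Census.LongCycleCore

open scoped TensorProduct Kronecker

section TensorRank

variable {K : Type*} [Field K]
variable {M N P Q : Type*} [AddCommGroup M] [Module K M] [AddCommGroup N] [Module K N]
  [AddCommGroup P] [Module K P] [AddCommGroup Q] [Module K Q]

/-- range(f ⊗ g) is the range of the inclusion (range f) ⊗ (range g) → P ⊗ Q. -/
theorem range_map_eq_range_mapIncl (f : M →ₗ[K] P) (g : N →ₗ[K] Q) :
    LinearMap.range (TensorProduct.map f g) =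
      LinearMap.range (TensorProduct.mapIncl (LinearMap.range f) (LinearMap.range g)) := by
  rw [TensorProduct.range_map, TensorProduct.range_mapIncl]

/-- RANK MULTIPLICATIVITY under ⊗ over a field: dim range(f ⊗ g) = dim range(f) · dim range(g). -/
theorem finrank_range_tensorProduct_map (f : M →ₗ[K] P) (g : N →ₗ[K] Q) :
    Module.finrank K (LinearMap.range (TensorProduct.map f g)) =
      Module.finrank K (LinearMap.range f) * Module.finrank K (LinearMap.range g) := by
  rw [range_map_eq_range_mapIncl]
  have hinj : Function.Injective
      (TensorProduct.mapIncl (LinearMap.range f) (LinearMap.range g)) :=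
    TensorProduct.map_injective_of_flat_flat _ _
      (Submodule.injective_subtype _) (Submodule.injective_subtype _)
  rw [LinearMap.finrank_range_of_inj hinj, Module.finrank_tensorProduct]

/-- DIRECT-SUM ADDITIVITY: dim range(f × g) = dim range(f) + dim range(g). -/
theorem finrank_range_prodMap [FiniteDimensional K P] [FiniteDimensional K Q]
    (f : M →ₗ[K] P) (g : N →ₗ[K] Q) :
    Module.finrank K (LinearMap.range (f.prodMap g)) =
      Module.finrank K (LinearMap.range f) + Module.finrank K (LinearMap.range g) := by
  rw [LinearMap.range_prodMap]
  have e : ((LinearMap.range f).prod (LinearMap.range g)) ≃ₗ[K]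
      (LinearMap.range f) × (LinearMap.range g) :=
    { toFun := fun x => (⟨x.1.1, x.2.1⟩, ⟨x.1.2, x.2.2⟩)
      invFun := fun y => ⟨(y.1.1, y.2.1), ⟨y.1.2, y.2.2⟩⟩
      map_add' := fun x y => rfl
      map_smul' := fun c x => rfl
      left_inv := fun x => rfl
      right_inv := fun y => rfl }
  rw [e.finrank_eq, Module.finrank_prod]

end TensorRank

section MatrixRank

variable {K : Type*} [Field K]
variable {m n p q : Type*} [Fintype m] [Fintype n] [Fintype p] [Fintype q]
  [DecidableEq m] [DecidableEq n] [DecidableEq p] [DecidableEq q]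

omit [DecidableEq m] [DecidableEq p] in
/-- RANK OF A KRONECKER PRODUCT over a field: rank (A ⊗ₖ B) = rank A · rank B. -/
theorem rank_kronecker (A : Matrix m n K) (B : Matrix p q K) :
    (A ⊗ₖ B).rank = A.rank * B.rank := by
  rw [Matrix.rank_eq_finrank_range_toLin (A ⊗ₖ B)
        ((Pi.basisFun K m).tensorProduct (Pi.basisFun K p))
        ((Pi.basisFun K n).tensorProduct (Pi.basisFun K q)),
    Matrix.toLin_kronecker, finrank_range_tensorProduct_map,
    ← Matrix.rank_eq_finrank_range_toLin A (Pi.basisFun K m) (Pi.basisFun K n),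
    ← Matrix.rank_eq_finrank_range_toLin B (Pi.basisFun K p) (Pi.basisFun K q)]

/-- sanity instance: the 2×2 identity ⊗ₖ a rank-one 2×2 matrix has rank 2 · 1. -/
example : ((1 : Matrix (Fin 2) (Fin 2) ℚ) ⊗ₖ !![(1 : ℚ), 1; 1, 1]).rank
    = (1 : Matrix (Fin 2) (Fin 2) ℚ).rank * (!![(1 : ℚ), 1; 1, 1]).rank :=
  rank_kronecker _ _

end MatrixRank

section Pigeonhole

/-- KILL CRITERION, all k (LONG-CYCLE-THEOREM-g27 Prop. C (i)–(iii)): a subset τ of ℤ/k with 2|τ| < k leaves two CONSECUTIVE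
residues i, i+1 outside it. -/
theorem exists_consecutive_outside {k : ℕ} [NeZero k] (τ : Finset (ZMod k)) (h : 2 * τ.card < k) :
    ∃ i : ZMod k, i ∉ τ ∧ i + 1 ∉ τ := by
  by_contra hcon
  push Not at hcon
  have hcov : (Finset.univ : Finset (ZMod k)) ⊆ τ ∪ τ.image (fun j => j - 1) := by
    intro i _
    by_cases hi : i ∈ τ
    · exact Finset.mem_union_left _ hi
    · exact Finset.mem_union_right _ (Finset.mem_image.mpr ⟨i + 1, hcon i hi, by ring⟩)
  have h1 := Finset.card_le_card hcov
  rw [Finset.card_univ, ZMod.card] at h1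
  have h2 : (τ ∪ τ.image (fun j => j - 1)).card ≤ τ.card + τ.card :=
    (Finset.card_union_le _ _).trans (Nat.add_le_add_left Finset.card_image_le _)
  omega

/-- t = 1, k ≥ 3. -/
theorem longCycle_kill_t1 {k : ℕ} [NeZero k] (hk : 3 ≤ k) (τ : Finset (ZMod k)) (ht : τ.card = 1) :
    ∃ i : ZMod k, i ∉ τ ∧ i + 1 ∉ τ :=
  exists_consecutive_outside τ (by omega)

/-- t = 2, k ≥ 5. -/
theorem longCycle_kill_t2 {k : ℕ} [NeZero k] (hk : 5 ≤ k) (τ : Finset (ZMod k)) (ht : τ.card = 2) :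
    ∃ i : ZMod k, i ∉ τ ∧ i + 1 ∉ τ :=
  exists_consecutive_outside τ (by omega)

/-- t = 3, k ≥ 7: EVERY triple of M-edge indices is killed at the first stage. -/
theorem longCycle_kill_t3 {k : ℕ} [NeZero k] (hk : 7 ≤ k) (τ : Finset (ZMod k)) (ht : τ.card = 3) :
    ∃ i : ZMod k, i ∉ τ ∧ i + 1 ∉ τ :=
  exists_consecutive_outside τ (by omega)

/-- The RESIDUAL subsets (criterion fails) are those meeting every pair {i, i+1}; written inline as a `Finset.filter` of
`powersetCard` (no new definition): membership = cardinality t and the kill criterion FAILS. -/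
theorem mem_residual_iff {k t : ℕ} [NeZero k] (τ : Finset (ZMod k)) :
    τ ∈ (Finset.univ.powersetCard t).filter (fun σ : Finset (ZMod k) => ∀ i : ZMod k, i ∈ σ ∨ i + 1 ∈ σ)
      ↔ τ.card = t ∧ ¬ ∃ i : ZMod k, i ∉ τ ∧ i + 1 ∉ τ := by
  simp [Finset.mem_powersetCard, imp_iff_not_or]

/-- k = 5, t = 3: the residual triples are the five rotations of {0,2,4} (Prop. C (v)). -/
theorem residual_k5 :
    (Finset.univ.powersetCard 3).filter (fun σ : Finset (ZMod 5) => ∀ i : ZMod 5, i ∈ σ ∨ i + 1 ∈ σ)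
      = {{0,2,4}, {1,3,0}, {2,4,1}, {3,0,2}, {4,1,3}} := by decide

/-- k = 6, t = 3: the residual triples are {0,2,4} and {1,3,5} (Prop. C (iv)). -/
theorem residual_k6 :
    (Finset.univ.powersetCard 3).filter (fun σ : Finset (ZMod 6) => ∀ i : ZMod 6, i ∈ σ ∨ i + 1 ∈ σ)
      = {{0,2,4}, {1,3,5}} := by decide

/-- k = 4, t = 2: the residual pairs are {0,2} and {1,3} (Prop. C (ii′)). -/
theorem residual_t2_k4 :
    (Finset.univ.powersetCard 2).filter (fun σ : Finset (ZMod 4) => ∀ i : ZMod 4, i ∈ σ ∨ i + 1 ∈ σ)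
      = {{0,2}, {1,3}} := by decide

/-- k = 7, t = 3: no residual triple (agrees with `longCycle_kill_t3`). -/
theorem residual_k7 :
    (Finset.univ.powersetCard 3).filter (fun σ : Finset (ZMod 7) => ∀ i : ZMod 7, i ∈ σ ∨ i + 1 ∈ σ)
      = ∅ := by decide

end Pigeonhole

end Summit.HodgeConjecture.HodgeConjecture.HodgeLocus.Census.LongCycleCore
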